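import Summits.AnomalousDissipation.AnomalousDissipation.Theorems.SawtoothPulseCascadeK1LocalisedCascadePhaseTwoStartBoxFibres

/-!
# K1loc, line `Spectral` / thin start — helper: PHASE-ONE FIBRE TABLE I — block × source energies of `a₁` (first-order explicit)

Helper file of the prover lane on the crux `K1LocalisedCascade` (stmt-AnomalousDissipation-19491), route `SawtoothPulseCascade`
(glue seat; arbiter A23-13 (1) / A23-14: phase-1 corner-trace dischargers with FIRST-ORDER inputs).  The energy-aware trace bound
`…TraceEnergy.sum_sq_trace_le_energy` for the T-H step of phase 1 consumes, per block `F` of `k₀`-fibres and per source `q`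
(a `k₁`-value of `a₁`), the energy `E_q^F = Σ_{n∈F} ‖𝓕a₁(n,q)‖²`.  From the mode formula `…PhaseOneModes.mFourierCoeff_phaseOne`
(`a₁ = (datum ∘ Φ_H) ∘ Φ_V`, profile `ψ`, `ĝ_n = 𝓕(twist ψ n)`):
* **`sum_block_sq_norm_phaseOne_le`**: `E_q^F ≤ ½(√w(|q|) + 2πη)²·(Σ_{n∈F}‖ĝ_q(n+1)‖² + Σ_{n∈F}‖ĝ_q(n−1)‖²)` at `γ = 8`
  (`|ψ − 8·tri(2π·)/(2π)| ≤ η`; `w` the weight table of `…ExactChirpSelf`) — the source weight times the WINDOW MASSES of the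
  fibre-`q` chirp (`λ = 8q`) over the shifted block;
* window masses: `sum_window_sq_norm_twist_le_one` (`≤ 1`, Bessel), `sqrt_sum_window_sq_norm_twist_le` (rounded ≤ exact `+ 2π|q|η`),
  and for the exact one-tooth chirp ABOVE its lobe `sum_window_sq_norm_exactChirp_le_of_above`
  (`|m| ≥ A > |λ|` on `W` ⇒ `≤ |W|·(2A/(π(A²−λ²)))²`; below the lobe: `…ExactChirp.sum_sq_norm_fourierCoeff_exactChirp_le`).
So `E_q^F` is explicit and small unless the block `F ± 1` meets a lobe `±8q` (sizing memo `CT-PHASE1-SIZING-k1locp3g4.md` §3).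
No definitions; nothing about the crux at `δ₀ = ¼`. [cite: Grafakos2014, Prop. 3.1.2 (5) and Prop. 3.2.7 (3)] [problem: turb]
-/

-- `Summit.<Summit>.<Problem>`: single-conjunct summit, the duplicate namespace segment is deliberate.
set_option linter.dupNamespace false

noncomputable section

namespace Summit.AnomalousDissipation.AnomalousDissipation.Theorems.SawtoothPulseCascade.K1Start

open MeasureTheory Set Filter Topology UnitAddTorus Function Complex AddCircle
open scoped Real
open Literature.Analysis Literature.Analysis.FunctionSpaces Literature.Analysis.FunctionSpaces.Torus Literature.Analysis.FluidPDE
open Literature.Analysis.FluidPDE.SawtoothCascade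

/-! ## §1 Window masses of a chirp -/

/-- **A chirp has window mass at most one**: `Σ_{m∈W} ‖ĝ_n(m)‖² ≤ 1` for `g_n = twist ψ n` (unimodular, Bessel).
[cite: Grafakos2014, Prop. 3.2.7 (3)] -/
theorem sum_window_sq_norm_twist_le_one (ψ : ShearProfile) (n : ℤ) (W : Finset ℤ) :
    ∑ m ∈ W, ‖fourierCoeff (twist ψ n) m‖ ^ 2 ≤ 1 := by
  have h := sum_sq_norm_fourierCoeff_le_of_norm_le (continuous_twist ψ n) (B := 1) (fun x => (norm_twist ψ n x).le) W
  simpa using h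

/-- **Rounded versus exact window mass**: if `|ψ − λ₁·tri(2π·)/(2π)| ≤ η` then for the fibre-`q` chirp (`λ = qλ₁`)
`√(Σ_{m∈W}‖ĝ_q(m)‖²) ≤ √(Σ_{m∈W}‖ĝ₀(m)‖²) + 2π|q|η`, `g₀` the exact chirp of frequency `qλ₁`. [cite: Grafakos2014, Prop. 3.2.7 (3)] -/
theorem sqrt_sum_window_sq_norm_twist_le (ψ : ShearProfile) (lam₁ q : ℤ) {g₀ : UnitAddCircle → ℂ}
    (hg₀ : ∀ t : ℝ, g₀ (t : UnitAddCircle) = Complex.exp (-(2 * π * I * ((q * lam₁ : ℤ)) * ((tri (2 * π * t) / (2 * π) : ℝ) : ℂ))))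
    (hg₀c : Continuous g₀) {η : ℝ} (hη : ∀ t : ℝ, |ψ t - lam₁ * (tri (2 * π * t) / (2 * π))| ≤ η) (W : Finset ℤ) :
    Real.sqrt (∑ m ∈ W, ‖fourierCoeff (twist ψ q) m‖ ^ 2) ≤
      Real.sqrt (∑ m ∈ W, ‖fourierCoeff g₀ m‖ ^ 2) + 2 * π * (|(q : ℝ)| * η) := by
  refine sqrt_sum_sq_norm_fourierCoeff_twist_le ψ q (q * lam₁) hg₀ hg₀c (fun t => ?_) W
  have h := hη t
  rw [show ((q * lam₁ : ℤ) : ℝ) * (tri (2 * π * t) / (2 * π)) = q * (lam₁ * (tri (2 * π * t) / (2 * π))) by push_cast; ring,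
    ← mul_sub, abs_mul]
  exact mul_le_mul_of_nonneg_left h (abs_nonneg _)

/-- **Window mass of the exact one-tooth chirp ABOVE its lobe**: if every `m ∈ W` has `|m| ≥ A > |λ|` then
`Σ_{m∈W}‖ĝ₀(m)‖² ≤ |W|·(2A/(π(A² − λ²)))²` (sidebands `1/(π|λ+m|) + 1/(π|λ−m|) = 2|m|/(π(m²−λ²))`, decreasing in `|m| > |λ|`).
[cite: Grafakos2014, Prop. 3.1.2 (5)] -/
theorem sum_window_sq_norm_exactChirp_le_of_above {lam : ℤ} {g₀ : UnitAddCircle → ℂ}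
    (hg₀ : ∀ t : ℝ, g₀ (t : UnitAddCircle) = Complex.exp (-(2 * π * I * lam * ((tri (2 * π * t) / (2 * π) : ℝ) : ℂ))))
    (hg₀c : Continuous g₀) {A : ℕ} (hA : |lam| < (A : ℤ)) (W : Finset ℤ) (hW : ∀ m ∈ W, (A : ℤ) ≤ |m|) :
    ∑ m ∈ W, ‖fourierCoeff g₀ m‖ ^ 2 ≤ W.card * (2 * (A : ℝ) / (π * ((A : ℝ) ^ 2 - (lam : ℝ) ^ 2))) ^ 2 := by
  have hπ : 0 < π := Real.pi_pos
  have hAr : |(lam : ℝ)| < (A : ℝ) := by exact_mod_cast hA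
  have hA0 : (0 : ℝ) < A := lt_of_le_of_lt (abs_nonneg _) hAr
  have hden : 0 < (A : ℝ) ^ 2 - (lam : ℝ) ^ 2 := by nlinarith [abs_nonneg (lam : ℝ), sq_abs (lam : ℝ)]
  have hterm : ∀ m ∈ W, ‖fourierCoeff g₀ m‖ ^ 2 ≤ (2 * (A : ℝ) / (π * ((A : ℝ) ^ 2 - (lam : ℝ) ^ 2))) ^ 2 := by
    intro m hm
    have hmA : (A : ℤ) ≤ |m| := hW m hm
    have hmr : (A : ℝ) ≤ |(m : ℝ)| := by exact_mod_cast hmA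
    have hml : |(lam : ℝ)| < |(m : ℝ)| := lt_of_lt_of_le hAr hmr
    have hq1 : m ≠ -lam := by intro h; rw [h] at hml; push_cast at hml; rw [abs_neg] at hml; exact lt_irrefl _ hml
    have hq2 : m ≠ lam := by intro h; rw [h] at hml; exact lt_irrefl _ hml
    have h1 := norm_fourierCoeff_exactChirp_le hg₀ hg₀c hq1 hq2
    -- `1/|λ+m| + 1/|λ−m| = 2|m|/(m² − λ²) ≤ 2A/(A² − λ²)`
    have hp : 0 < |(m : ℝ)| - |(lam : ℝ)| := by linarith
    have e1 : |((lam + m : ℤ) : ℝ)| ≥ |(m : ℝ)| - |(lam : ℝ)| := by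
      push_cast
      have := abs_sub_abs_le_abs_sub (m : ℝ) (-(lam : ℝ))
      rw [abs_neg, sub_neg_eq_add, add_comm] at this
      exact this
    have e2 : |((lam - m : ℤ) : ℝ)| ≥ |(m : ℝ)| - |(lam : ℝ)| := by
      push_cast
      have := abs_sub_abs_le_abs_sub (m : ℝ) (lam : ℝ)
      rw [abs_sub_comm] at this
      exact this
    have hpos1 : 0 < |((lam + m : ℤ) : ℝ)| := lt_of_lt_of_le hp e1
    have hpos2 : 0 < |((lam - m : ℤ) : ℝ)| := lt_of_lt_of_le hp e2
    have hprod : |((lam + m : ℤ) : ℝ)| * |((lam - m : ℤ) : ℝ)| = (m : ℝ) ^ 2 - (lam : ℝ) ^ 2 := by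
      rw [← abs_mul]
      push_cast
      rw [show ((lam : ℝ) + m) * (lam - m) = -((m : ℝ) ^ 2 - (lam : ℝ) ^ 2) by ring, abs_neg,
        abs_of_pos (by nlinarith [sq_abs (m : ℝ), sq_abs (lam : ℝ), abs_nonneg (lam : ℝ)])]
    have hsum : |((lam + m : ℤ) : ℝ)| + |((lam - m : ℤ) : ℝ)| ≤ 2 * |(m : ℝ)| := by
      push_cast
      rcases le_or_gt 0 (m : ℝ) with h₃ | h₃
      · rw [abs_of_nonneg h₃] at hml ⊢
        obtain ⟨hl1, hl2⟩ := abs_lt.1 hml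
        rw [abs_of_pos (by linarith : (0 : ℝ) < lam + m), abs_of_neg (by linarith : (lam : ℝ) - m < 0)]
        linarith
      · rw [abs_of_neg h₃] at hml ⊢
        obtain ⟨hl1, hl2⟩ := abs_lt.1 hml
        rw [abs_of_neg (by linarith : (lam : ℝ) + m < 0), abs_of_pos (by linarith : (0 : ℝ) < lam - m)]
        linarith
    have h2 : 1 / (π * |((lam + m : ℤ) : ℝ)|) + 1 / (π * |((lam - m : ℤ) : ℝ)|) =
        (|((lam + m : ℤ) : ℝ)| + |((lam - m : ℤ) : ℝ)|) / (π * ((m : ℝ) ^ 2 - (lam : ℝ) ^ 2)) := by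
      rw [← hprod]
      field_simp
      ring
    have hm2 : 0 < (m : ℝ) ^ 2 - (lam : ℝ) ^ 2 := by rw [← hprod]; positivity
    have h3 : (|((lam + m : ℤ) : ℝ)| + |((lam - m : ℤ) : ℝ)|) / (π * ((m : ℝ) ^ 2 - (lam : ℝ) ^ 2)) ≤
        2 * |(m : ℝ)| / (π * ((m : ℝ) ^ 2 - (lam : ℝ) ^ 2)) :=
      div_le_div_of_nonneg_right hsum (by positivity)
    -- monotonicity in `|m| ≥ A`: `2|m|/(m²−λ²) ≤ 2A/(A²−λ²)`
    have h4 : 2 * |(m : ℝ)| / (π * ((m : ℝ) ^ 2 - (lam : ℝ) ^ 2)) ≤ 2 * (A : ℝ) / (π * ((A : ℝ) ^ 2 - (lam : ℝ) ^ 2)) := by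
      rw [div_le_div_iff₀ (by positivity) (by positivity)]
      have hmsq : (m : ℝ) ^ 2 = |(m : ℝ)| ^ 2 := (sq_abs _).symm
      rw [hmsq]
      have hl2 : (lam : ℝ) ^ 2 = |(lam : ℝ)| ^ 2 := (sq_abs _).symm
      rw [hl2]
      have hx : 0 ≤ |(m : ℝ)| - (A : ℝ) := by linarith
      nlinarith [mul_nonneg hx (by positivity : (0 : ℝ) ≤ π * (|(m : ℝ)| * A + |(lam : ℝ)| ^ 2)),
        abs_nonneg (lam : ℝ), hπ]
    have h0 : 0 ≤ ‖fourierCoeff g₀ m‖ := norm_nonneg _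
    calc ‖fourierCoeff g₀ m‖ ^ 2 ≤ (1 / (π * |((lam + m : ℤ) : ℝ)|) + 1 / (π * |((lam - m : ℤ) : ℝ)|)) ^ 2 :=
          pow_le_pow_left₀ h0 h1 2
      _ ≤ (2 * (A : ℝ) / (π * ((A : ℝ) ^ 2 - (lam : ℝ) ^ 2))) ^ 2 := by
          refine pow_le_pow_left₀ (by positivity) ?_ 2
          rw [h2]; exact h3.trans h4
  refine (Finset.sum_le_sum hterm).trans ?_
  rw [Finset.sum_const, nsmul_eq_mul]

/-! ## §2 Block × source energies of `a₁` -/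

/-- **BLOCK × SOURCE ENERGY OF `a₁` AT `γ = 8`**: for `b = datum ∘ Φ_H(ψ)`, `a = b ∘ Φ_V(ψ)`, `|ψ − 8·tri(2π·)/(2π)| ≤ η`, a finite
block `F` of horizontal frequencies and a source `q`,
`Σ_{n∈F} ‖𝓕a(n,q)‖² ≤ ½(√w(|q|) + 2πη)²·(Σ_{n∈F}‖ĝ_q(n+1)‖² + Σ_{n∈F}‖ĝ_q(n−1)‖²)`, `ĝ_q = 𝓕(twist ψ q)`, `w` the weight table.
[cite: Grafakos2014, Prop. 3.1.2 (5) and Prop. 3.2.7 (3)] -/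
theorem sum_block_sq_norm_phaseOne_le (ψ : ShearProfile) {b a : UnitAddTorus (Fin 2) → ℝ}
    (hb : b = datum ∘ shearMap 0 1 ψ) (ha : a = b ∘ shearMap 1 0 ψ) {η : ℝ}
    (hη : ∀ t : ℝ, |ψ t - (8 : ℤ) * (tri (2 * π * t) / (2 * π))| ≤ η) (F : Finset ℤ) (q : ℤ) :
    ∑ n ∈ F, ‖mFourierCoeff (fun x => (a x : ℂ)) ![n, q]‖ ^ 2 ≤
      1 / 2 * (Real.sqrt (if Odd q.natAbs then (1 / (π * ((8 : ℝ) + q.natAbs)) + 1 / (π * |(8 : ℝ) - q.natAbs|)) ^ 2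
          else if q.natAbs = 8 then (1 / 4 : ℝ) else 0) + 2 * π * η) ^ 2 *
        (∑ n ∈ F, ‖fourierCoeff (twist ψ q) (n + 1)‖ ^ 2 + ∑ n ∈ F, ‖fourierCoeff (twist ψ q) (n - 1)‖ ^ 2) := by
  set wq : ℝ := (if Odd q.natAbs then (1 / (π * ((8 : ℝ) + q.natAbs)) + 1 / (π * |(8 : ℝ) - q.natAbs|)) ^ 2
    else if q.natAbs = 8 then (1 / 4 : ℝ) else 0) with hwq
  have hwq0 : 0 ≤ wq := by rw [hwq]; split_ifs <;> positivity
  have hη0 : 0 ≤ η := (abs_nonneg _).trans (hη 0)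
  -- the two source weights `‖ĝ_{±1}(q)‖² ≤ (√w + 2πη)²`
  obtain ⟨gp, hgpc, hgp⟩ := exists_exactChirp 8
  obtain ⟨gm, hgmc, hgm⟩ := exists_exactChirp (-8)
  have hηp : ∀ t : ℝ, |(1 : ℤ) * ψ t - (8 : ℤ) * (tri (2 * π * t) / (2 * π))| ≤ η := fun t => by simpa using hη t
  have hηm : ∀ t : ℝ, |(-1 : ℤ) * ψ t - (-8 : ℤ) * (tri (2 * π * t) / (2 * π))| ≤ η := fun t => by
    have h := hη t
    rw [show ((-1 : ℤ) : ℝ) * ψ t - ((-8 : ℤ) : ℝ) * (tri (2 * π * t) / (2 * π)) =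
      -(ψ t - ((8 : ℤ) : ℝ) * (tri (2 * π * t) / (2 * π))) by push_cast; ring, abs_neg]
    exact h
  have hp := norm_fourierCoeff_twist_le_of_near ψ 1 8 hgp hgpc hηp q
  have hm := norm_fourierCoeff_twist_le_of_near ψ (-1) (-8) hgm hgmc hηm q
  have hwp : ‖fourierCoeff gp q‖ ^ 2 ≤ wq :=
    (sq_norm_fourierCoeff_exactChirp_eight_le (Or.inl rfl) hgp hgpc q).trans (by rw [hwq]; exact weightTable_le_natAbs q)
  have hwm : ‖fourierCoeff gm q‖ ^ 2 ≤ wq :=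
    (sq_norm_fourierCoeff_exactChirp_eight_le (Or.inr rfl) hgm hgmc q).trans (by rw [hwq]; exact weightTable_le_natAbs q)
  have hsp : ‖fourierCoeff gp q‖ ≤ Real.sqrt wq := Real.le_sqrt_of_sq_le hwp
  have hsm : ‖fourierCoeff gm q‖ ≤ Real.sqrt wq := Real.le_sqrt_of_sq_le hwm
  have h1 : ‖fourierCoeff (twist ψ 1) q‖ ≤ Real.sqrt wq + 2 * π * η := hp.trans (by linarith)
  have h2 : ‖fourierCoeff (twist ψ (-1)) q‖ ≤ Real.sqrt wq + 2 * π * η := hm.trans (by linarith)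
  have h0 : 0 ≤ Real.sqrt wq + 2 * π * η := by positivity
  have e1 : ‖fourierCoeff (twist ψ 1) q‖ ^ 2 ≤ (Real.sqrt wq + 2 * π * η) ^ 2 := pow_le_pow_left₀ (norm_nonneg _) h1 2
  have e2 : ‖fourierCoeff (twist ψ (-1)) q‖ ^ 2 ≤ (Real.sqrt wq + 2 * π * η) ^ 2 := pow_le_pow_left₀ (norm_nonneg _) h2 2
  -- termwise mode bound, then sum
  have hterm : ∀ n ∈ F, ‖mFourierCoeff (fun x => (a x : ℂ)) ![n, q]‖ ^ 2 ≤
      1 / 2 * (Real.sqrt wq + 2 * π * η) ^ 2 * (‖fourierCoeff (twist ψ q) (n + 1)‖ ^ 2 + ‖fourierCoeff (twist ψ q) (n - 1)‖ ^ 2) := by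
    intro n _
    have h := sq_norm_mFourierCoeff_phaseOne_le ψ hb ![n, q]
    rw [← ha] at h
    simp only [Matrix.cons_val_zero, Matrix.cons_val_one] at h
    have hA0 : 0 ≤ ‖fourierCoeff (twist ψ q) (n + 1)‖ ^ 2 := sq_nonneg _
    have hB0 : 0 ≤ ‖fourierCoeff (twist ψ q) (n - 1)‖ ^ 2 := sq_nonneg _
    calc ‖mFourierCoeff (fun x => (a x : ℂ)) ![n, q]‖ ^ 2
        ≤ 1 / 2 * (‖fourierCoeff (twist ψ q) (n + 1)‖ ^ 2 * ‖fourierCoeff (twist ψ (-1)) q‖ ^ 2 +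
            ‖fourierCoeff (twist ψ q) (n - 1)‖ ^ 2 * ‖fourierCoeff (twist ψ 1) q‖ ^ 2) := h
      _ ≤ 1 / 2 * (‖fourierCoeff (twist ψ q) (n + 1)‖ ^ 2 * (Real.sqrt wq + 2 * π * η) ^ 2 +
            ‖fourierCoeff (twist ψ q) (n - 1)‖ ^ 2 * (Real.sqrt wq + 2 * π * η) ^ 2) := by
          gcongr
      _ = _ := by ring
  refine (Finset.sum_le_sum hterm).trans (le_of_eq ?_)
  rw [← Finset.mul_sum, Finset.sum_add_distrib]

end Summit.AnomalousDissipation.AnomalousDissipation.Theorems.SawtoothPulseCascade.K1Start
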